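import Literature.NumberTheory.Automorphic.UnitaryGroupAdelicOneTorus
import HarnessLib

/-!
# The centre `u ↦ u · 1_N` of `U(J)(𝔸_F)` carries PRINCIPAL norm-one ideles to RATIONAL points

For a quadratic extension `E/F` with non-trivial automorphism `c`, the centre embedding
`UnitaryGroup.adelicCenter : U(1)(𝔸_F) →* U(J)(𝔸_F)`, `u ↦ u · 1_N` (`UnitaryGroupAdelicCenter`), sends a
norm-one idele `u` which is PRINCIPAL (`u = (ℓ)`, `ℓ ∈ Eˣ`, `c(ℓ) ℓ = 1`) to the image of the rational point
`ℓ · 1_N ∈ U(J)(F)` under the diagonal embedding `UnitaryGroup.toAdelic : U(J)(F) →* U(J)(𝔸_F)`: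

* `UnitaryGroup.ratCenter` — the rational centre `ℓ ↦ ℓ · 1_N : {ℓ ∈ Eˣ | c(ℓ) ℓ = 1} → U(J)(F)` as a group
  homomorphism on the subgroup `UnitaryGroup.ratOne F E c ≤ Eˣ`;
* `UnitaryGroup.toAdelic_ratCenter` — `toAdelic (ℓ · 1_N) = (ℓ) · 1_N`;
* `UnitaryGroup.adelicCenter_mem_range_toAdelic` — **`u · 1_N ∈ U(J)(F)` (i.e. lies in the range of
  `toAdelic`) whenever `u ∈ U(1)(𝔸_F)` is a principal idele**;
* the same in the idele-torus currency `ker N_{E/F}` (`adelicOneEquivRelNormOne`, `relNormOneRat`) and in the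
  CM case `E = L`, `F = L⁺` (`cmAdelicOneEquivRelNormOne`): `adelicCenter_symm_mem_range_toAdelic`,
  `cm_adelicCenter_symm_mem_range_toAdelic`.

This is the rationality input for the torus factor of every see-saw LINE representation (the torus
`U(W_k)(𝔸) = U(1)(𝔸)` acts on a line through the centre of `U(⟨a_k⟩)`; its rational points `U(1)(F) = E¹` must
land in the rational points of the unitary group for Weil's `Θ`-invariance [Weil1964, n°41 Thm 6] to apply).

References: [Mok2014, §1 Notation p. 5] ("we identify the centre of `U_{E/F}(N)` as `U_{E/F}(1)`");
[PlatonovRapinchuk1994, §6.2] (the norm-one torus and its rational points). KERNEL ONLY: 0 records, 0 named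
facts, 0 sorry. Model-construction cell pub-hodgecm, row `S` (S-restr) of BINDER-OWNERS (period lane): the
`theta_rat` field of the S-side line data.
-/

set_option autoImplicit false

noncomputable section

open NumberField

namespace Literature.NumberTheory.Automorphic

namespace UnitaryGroup

section Quadratic

variable (F E : Type) [Field F] [Field E] [NumberField E] [Algebra F E] (c : E ≃ₐ[F] E)
  (N : ℕ) (J : Matrix (Fin N) (Fin N) E)

/-- **`U(1)(F) = E¹`** as a subgroup of `Eˣ`: the elements `ℓ` with `c(ℓ) · ℓ = 1`. [cite: Mok2014, §1 Notation p. 5] -/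
def ratOne : Subgroup Eˣ where
  carrier := {ℓ | (c : E →+* E) (ℓ : E) * ℓ = 1}
  one_mem' := by
    show (c : E →+* E) ((1 : Eˣ) : E) * _ = 1
    rw [Units.val_one, map_one, one_mul]
  mul_mem' {a b} ha hb := by
    have ha' : (c : E →+* E) (a : E) * a = 1 := ha
    have hb' : (c : E →+* E) (b : E) * b = 1 := hb
    show (c : E →+* E) ((a * b : Eˣ) : E) * _ = 1
    rw [Units.val_mul, map_mul, mul_mul_mul_comm, ha', hb', one_mul]
  inv_mem' {a} ha := by
    have ha' : (c : E →+* E) (a : E) * a = 1 := ha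
    show (c : E →+* E) ((a⁻¹ : Eˣ) : E) * _ = 1
    have h : (c : E →+* E) ((a⁻¹ : Eˣ) : E) * ((a⁻¹ : Eˣ) : E) * ((c : E →+* E) (a : E) * a) = 1 := by
      rw [mul_mul_mul_comm, ← map_mul, Units.inv_mul, map_one, one_mul]
    rwa [ha', mul_one] at h

omit [NumberField E] in
/-- membership in `E¹`: `c(ℓ) ℓ = 1`. [cite: Mok2014, §1 Notation p. 5] -/
theorem mem_ratOne_iff (ℓ : Eˣ) : ℓ ∈ ratOne F E c ↔ (c : E →+* E) (ℓ : E) * ℓ = 1 := Iff.rfl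

/-- **the principal idele of a norm-one element is a norm-one idele**: `(ℓ) ∈ U(1)(𝔸_F)` for `ℓ ∈ E¹`.
[cite: Mok2014, §1 Notation p. 5] -/
theorem principal_mem_adelicOne (ℓ : Eˣ) (hℓ : ℓ ∈ ratOne F E c) :
    Units.map (algebraMap E (AdeleRing (𝓞 E) E) : E →* AdeleRing (𝓞 E) E) ℓ ∈ adelicOne F E c := by
  rw [mem_adelicOne_iff, Units.coe_map, MonoidHom.coe_coe, ← algebraMap_conj F E c, ← map_mul,
    (mem_ratOne_iff F E c ℓ).1 hℓ, map_one]

/-- conversely, a PRINCIPAL idele `(ℓ)` lying in `U(1)(𝔸_F)` has `ℓ ∈ E¹` (`E → 𝔸_E` is injective). [folklore] -/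
theorem mem_ratOne_of_principal_mem_adelicOne (ℓ : Eˣ)
    (hℓ : Units.map (algebraMap E (AdeleRing (𝓞 E) E) : E →* AdeleRing (𝓞 E) E) ℓ ∈ adelicOne F E c) :
    ℓ ∈ ratOne F E c := by
  rw [mem_adelicOne_iff, Units.coe_map, MonoidHom.coe_coe, ← algebraMap_conj F E c, ← map_mul] at hℓ
  exact (mem_ratOne_iff F E c ℓ).2 (AdeleRing.algebraMap_injective (𝓞 E) E (hℓ.trans (map_one _).symm))

/-- **the rational centre** `ℓ ↦ ℓ · 1_N : E¹ →* U(J)(F)` (`scalar_mem_unitaryGroupOfForm`).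
[cite: Mok2014, §1 Notation p. 5] -/
def ratCenter : ratOne F E c →* rational F E c N J :=
  MonoidHom.codRestrict
    ((Units.map (Matrix.scalar (Fin N) : E →+* Matrix (Fin N) (Fin N) E).toMonoidHom).comp (ratOne F E c).subtype)
    (rational F E c N J) fun ℓ => scalar_mem_unitaryGroupOfForm _ _ _ ℓ.2

omit [NumberField E] in
/-- underlying matrix of the rational central element: the scalar matrix `ℓ · 1_N`. [folklore] -/
@[simp] theorem coe_ratCenter (ℓ : ratOne F E c) :
    (((ratCenter F E c N J ℓ : rational F E c N J) : GL (Fin N) E) : Matrix (Fin N) (Fin N) E) =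
      ((ℓ : Eˣ) : E) • (1 : Matrix (Fin N) (Fin N) E) :=
  (Matrix.smul_one_eq_diagonal _).symm

/-- underlying matrix of `toAdelic γ`: the entrywise diagonal embedding of the matrix of `γ`. [folklore] -/
theorem coe_toAdelic (γ : rational F E c N J) :
    (((toAdelic F E c N J γ : adelic F E c N J) : GL (Fin N) (AdeleRing (𝓞 E) E)) :
        Matrix (Fin N) (Fin N) (AdeleRing (𝓞 E) E)) =
      ((γ : GL (Fin N) E) : Matrix (Fin N) (Fin N) E).map (algebraMap E (AdeleRing (𝓞 E) E)) :=
  rfl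

/-- the principal norm-one idele `(ℓ)` of `ℓ ∈ E¹`, as an element of `U(1)(𝔸_F)`. [folklore] -/
def principalOne (ℓ : ratOne F E c) : adelicOne F E c :=
  ⟨Units.map (algebraMap E (AdeleRing (𝓞 E) E) : E →* AdeleRing (𝓞 E) E) ℓ, principal_mem_adelicOne F E c ℓ ℓ.2⟩

/-- underlying idele of `principalOne ℓ`: the principal idele `(ℓ)`. [folklore] -/
@[simp] theorem coe_principalOne (ℓ : ratOne F E c) :
    ((principalOne F E c ℓ : adelicOne F E c) : (AdeleRing (𝓞 E) E)ˣ) =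
      Units.map (algebraMap E (AdeleRing (𝓞 E) E) : E →* AdeleRing (𝓞 E) E) ℓ :=
  rfl

/-- **`toAdelic (ℓ · 1_N) = (ℓ) · 1_N`**: the diagonal embedding of the rational centre is the adelic centre of
the principal idele. [cite: Mok2014, §1 Notation p. 5] -/
theorem toAdelic_ratCenter (ℓ : ratOne F E c) :
    toAdelic F E c N J (ratCenter F E c N J ℓ) = adelicCenter F E c N J (principalOne F E c ℓ) := by
  refine Subtype.ext (Units.ext ?_)
  rw [coe_toAdelic, coe_ratCenter, coe_adelicCenter, coe_principalOne, Units.coe_map, MonoidHom.coe_coe,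
    Matrix.smul_one_eq_diagonal, Matrix.smul_one_eq_diagonal, Matrix.diagonal_map (map_zero _)]

/-- **THE CENTRE CARRIES PRINCIPAL NORM-ONE IDELES TO RATIONAL POINTS**: if `u ∈ U(1)(𝔸_F)` is a principal
idele then `u · 1_N ∈ U(J)(𝔸_F)` lies in (the image under `toAdelic` of) `U(J)(F)`.
[cite: Mok2014, §1 Notation p. 5] -/
theorem adelicCenter_mem_range_toAdelic (u : adelicOne F E c)
    (hu : ((u : (AdeleRing (𝓞 E) E)ˣ)) ∈ GaloisRepresentations.principalIdeles E) :
    adelicCenter F E c N J u ∈ (toAdelic F E c N J).range := by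
  obtain ⟨ℓ, hℓ⟩ := hu
  have hℓ1 : ℓ ∈ ratOne F E c := mem_ratOne_of_principal_mem_adelicOne F E c ℓ (hℓ ▸ u.2)
  refine ⟨ratCenter F E c N J ⟨ℓ, hℓ1⟩, ?_⟩
  rw [toAdelic_ratCenter]
  congr 1
  exact Subtype.ext hℓ

variable [FiniteDimensional F E]

/-- the same in the idele-torus currency: for `t ∈ U(1)_{E/F}(F)` (`relNormOneRat`, principal ideles of relative
norm one), the central element of `U(J)(𝔸_F)` attached to `t` through `adelicOneEquivRelNormOne⁻¹` is rational.
[cite: PlatonovRapinchuk1994, §6.2] -/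
theorem adelicCenter_symm_mem_range_toAdelic (h2 : Module.finrank F E = 2) (hc : c ≠ 1)
    (t : ↥(relNormOneIdeles F E)) (ht : t ∈ relNormOneRat F E) :
    adelicCenter F E c N J ((adelicOneEquivRelNormOne F E c h2 hc).symm t) ∈ (toAdelic F E c N J).range :=
  adelicCenter_mem_range_toAdelic F E c N J _ ((mem_relNormOneRat_iff F E t).1 ht)

end Quadratic

section CM

variable (L : Type) [Field L] [NumberField L] [IsCMField L] (N : ℕ) (J : Matrix (Fin N) (Fin N) L)

/-- **the CM case**: for `t ∈ U(1)_{L/L⁺}(L⁺)` (a principal idele of `L` of relative norm one), the central element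
`t · 1_N ∈ U(J)(𝔸_{L⁺})` (through `cmAdelicOneEquivRelNormOne⁻¹`) is a rational point of `U(J)`.
[cite: PlatonovRapinchuk1994, §6.2] -/
theorem cm_adelicCenter_symm_mem_range_toAdelic (t : ↥(relNormOneIdeles (↥(maximalRealSubfield L)) L))
    (ht : t ∈ relNormOneRat (↥(maximalRealSubfield L)) L) :
    adelicCenter (↥(maximalRealSubfield L)) L (IsCMField.complexConj L) N J ((cmAdelicOneEquivRelNormOne L).symm t) ∈
      (toAdelic (↥(maximalRealSubfield L)) L (IsCMField.complexConj L) N J).range :=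
  adelicCenter_mem_range_toAdelic _ L _ N J _ ((mem_relNormOneRat_iff _ L t).1 ht)

/-- membership form: the underlying idele of `(cmAdelicOneEquivRelNormOne L).symm t` is that of `t`. [folklore] -/
@[simp] theorem coe_cmAdelicOneEquivRelNormOne_symm (t : ↥(relNormOneIdeles (↥(maximalRealSubfield L)) L)) :
    (((cmAdelicOneEquivRelNormOne L).symm t :
        adelicOne (↥(maximalRealSubfield L)) L (IsCMField.complexConj L)) : (AdeleRing (𝓞 L) L)ˣ) = t :=
  rfl

end CM

end UnitaryGroup

end Literature.NumberTheory.Automorphic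

end
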